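import Summits.QuantumFields.YangMills.Theorems.BalabanUVNodesPortZDStepUnit
import Summits.QuantumFields.YangMills.Theorems.BalabanUVNodesPortS1Functional
import Summits.QuantumFields.YangMills.Theorems.BalabanUVNodesPortS1Selector

/-!
# Port S1 — FE-1's NORMALISATION ROW R9 ∕ (N-0) AT THE RECORD: `recordΦfAx … k v K 0 = 0` («𝐍_k = the integral above at U_{k+1} = 1», [I] (2.12)∕(2.14) p.268), GIVEN the invariance of `A_k`
# at the one configuration it is read at — the EXACT residual hypothesis, located (hand-27930-FE-1 g0 l.≈5976; ◇ lens-1 g14 l.≈5987; ★★★ №615 (2))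

Cell `ym-nodeO-ideate`, porter seat PT-A-1 (gen 10); `--kind proof --supports stmt-QuantumFields-27930 --as helper`; count-neutral.  [I] = [Balaban1987RG1]; [15] = [Balaban1985Variational].
Over PTZ-1's ✓`…PortZDStepUnit` (`PortZD.effActionHT_one` — `A_k(1) = 0` for EVERY transport; `mergedTermT_one_of_gaugeInvariant` under GLOBAL `GaugeInvariant A_k`), lit ✓`Node00.ZeroInputStepT.mergedTermT_eq_stepOut`,
✓`PortZD.stepOutT_one`, ✓`…PortS1Functional.recordΦfAx_eq_mergedTermT_unitField`, ✓`…PortS1Selector.unitField_zero`.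

WHAT IS PROVED.
* ★★ `recordΦfAx_apply_zero_of_eq` — `recordΦfAx F a₀ ε₂₉ k v K 0 = 0` GIVEN ONLY `A_k(Ū^k(U_{k+1}(1))) = A_k(1)` for the record's transport∕cut-off at history `extd v` (the value of `A_k = effActionHT (TβOfRecord₁₃) (χAx) K (extd v) k` at the k-fold
  average of the CHOSEN level-`(k+1)` minimiser over `W = 1` equals its value at `1`): `𝓝_{k+1}(1) = A_{k+1}(1) − A_k(Ū^k U_{k+1}(1)) = 0 − A_k(1) = 0` (`nextAction_one`, `effActionHT_one`).  THIS is the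
  located residual of FE-1's presupposition: by N09-w4's ✓`orbitRel_one_Uk_one` the chosen minimiser is a residual pure gauge `1^u`, `Ū^k(1^u) = 1^{u↾}` (`iter_gaugeAct`), so the hypothesis is
  the invariance of `A_k` AT THE UNIT ORBIT ONLY — a `regSetOfRecord` door at `1` (◇ lens-1: lit `gaugeAct_mem_regSetOfRecord_iff` :443 + ✓`…N09AtRecord13SepCoPHSupportAE` :127 + N09 membership of `1`),
  NOT the global invariance ◆ Q-3 withholds at the bare record.
* `recordΦfAx_apply_zero_of_gaugeInvariant` — the same from GLOBAL `GaugeInvariant A_k` (PTZ-1's `mergedTermT_one_of_gaugeInvariant` BY NAME) — the over-strong edition, for comparison.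

HONEST FRAMING.  Bookkeeping at one datum; the door itself (`A_k` invariant at the unit orbit from ⁸'s antecedent) is NOT discharged here; nothing of Bałaban's estimates asserted, ported or discharged;
`FEChartLawStep`∕`FEStepBox` inhabited nowhere; `stub_P0C`∕`stub_FEstep` OPEN; ⟨27930⟩ OPEN 1∕3; NODE O 0∕1; COUNT 8∕28 · K 1∕4 UNMOVED; finite `𝕋⁴_{L^K}` at fixed ε — NOT continuum ∕ OS; **the Yang–Mills
mass gap (Clay) is NOT proved by any of this.**  No `sorry`, no `def`, no `instance`; standard axioms only.
-/

noncomputable section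

open scoped BigOperators Matrix.Norms.L2Operator

namespace Summit.QuantumFields.YangMills.Theorems.BalabanUVNodesPortS1

open Summit.QuantumFields.YangMills.Theorems.K0RecordFormatNames
open Literature.MathematicalPhysics.QuantumFieldTheory.Balaban1983to89
open Literature.MathematicalPhysics.QuantumFieldTheory.Balaban1983to89.Node00
open Literature.MathematicalPhysics.QuantumFieldTheory.Balaban1983to89.Node00.ZeroInput
open Literature.MathematicalPhysics.QuantumFieldTheory.Balaban1983to89.T4Continuum (T4Family)

variable (F : T4Family)

/-- ★★ **`recordΦfAx … 0 = 0` GIVEN `A_k(Ū^k(U_{k+1}(1))) = A_k(1)`** (the record's transport `TβOfRecord₁₃`, cut-off `χ^{Ax}`, radius `a₀ > 0`, history `extd v`): `𝓝_{k+1}(1) = A_{k+1}(1) − A_k(Ū^k U_{k+1}(1))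
= 0 − A_k(1) = 0`. [cite: Balaban1987RG1, (2.12) p.268 («the normalization constant … at U_{k+1} = 1»), (0.19) p.255, (1.6) p.261] -/
theorem recordΦfAx_apply_zero_of_eq (a₀ ε₂₉ : ℝ) (k : ℕ) (v : Fin (k + 1) → ℝ) (K : ℕ)
    (hinv : letI θ := thetaFill F a₀ ε₂₉
      effActionHT F 2 (TβOfRecord₁₃ F 2) (chiβOfRecord₁₃Ax F 2 θ) K (T4FlagMemory.extd v) k
          (Averaging.iter (avOfRecord F 2 K) k (Uk F 2 K (k + 1) θ.εbg 1)) =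
        effActionHT F 2 (TβOfRecord₁₃ F 2) (chiβOfRecord₁₃Ax F 2 θ) K (T4FlagMemory.extd v) k 1) :
    letI θ := thetaFill F a₀ ε₂₉
    letI := θ.instVβ₁; letI := θ.instVβ₂
    recordΦfAx F a₀ ε₂₉ k v K 0 = 0 := by
  rw [recordΦfAx_eq_mergedTermT_unitField, unitField_zero, mergedTermT_eq_stepOut, PortZD.stepOutT_one, hinv, PortZD.effActionHT_one, neg_zero,
    Complex.ofReal_zero]

/-- The over-strong edition: `recordΦfAx … 0 = 0` from GLOBAL gauge invariance of `A_k` (PTZ-1's ✓`mergedTermT_one_of_gaugeInvariant`; `a₀ > 0`, `k + 1 ≤ m + K`).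
[cite: Balaban1987RG1, (2.12) p.268, (1.6) p.261, (2.16) p.269] -/
theorem recordΦfAx_apply_zero_of_gaugeInvariant (a₀ ε₂₉ : ℝ) (ha₀ : 0 < a₀) (k : ℕ) (v : Fin (k + 1) → ℝ) (K : ℕ) (hk : k + 1 ≤ (F.P K).m + (F.P K).K)
    (hinv : GaugeField.GaugeInvariant (effActionHT F 2 (TβOfRecord₁₃ F 2) (chiβOfRecord₁₃Ax F 2 (thetaFill F a₀ ε₂₉)) K (T4FlagMemory.extd v) k)) :
    letI θ := thetaFill F a₀ ε₂₉
    letI := θ.instVβ₁; letI := θ.instVβ₂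
    recordΦfAx F a₀ ε₂₉ k v K 0 = 0 := by
  have hε : 0 < (thetaFill F a₀ ε₂₉).εbg := by
    show 0 < (theta13OfThm1CCMWZB F 2 0 (1 / 2) a₀ 1 ε₂₉ 0 0 a₀ 0 (fun _ _ => 0) (fun _ _ => 0)).εbg
    rw [theta13OfThm1CCMWZB_εbg]; exact ha₀
  rw [recordΦfAx_eq_mergedTermT_unitField, unitField_zero,
    PortZD.mergedTermT_one_of_gaugeInvariant F 2 (TβOfRecord₁₃ F 2) (chiβOfRecord₁₃Ax F 2 (thetaFill F a₀ ε₂₉)) hε (T4FlagMemory.extd v) hk hinv, Complex.ofReal_zero]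

end Summit.QuantumFields.YangMills.Theorems.BalabanUVNodesPortS1

end
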